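import Summits.QuantumFields.BalabanUV.Beta.GAN24.SymContactBorderCellLetters
import Summits.QuantumFields.BalabanUV.Beta.GAN24.SymContactLambdaEntryBound
import Summits.QuantumFields.BalabanUV.Beta.GAN24.ContactBorderEntryBound
import Summits.QuantumFields.BalabanUV.Beta.GAN24.SymContactBorderCommutator

/-!
# `GAN24.SymContactBorderEntryBound` — (B2) at an1's symmetrised tables: THE V CELL SUMS AND THE ENTRY BOUND OF THE fm-CHANNEL V CONTACT DIFFERENCE FROM LETTERS
# (generic `d`, legs ∕ gauge staircase ∕ multiplier tent abstract) — the sym twin of leaf-03's (E) `GAN24.ContactBorderEntryBound` (the count constant `sum_abs_symLinCountAt_le_cnt` is leaf-01 g90's S8 `SymContactLambdaEntryBound`'s, BY NAME)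

NOT IN PRINT — OUR BOOKKEEPING (OWNER `b2b-balaban-gan24-p1` gen 55, 2026-08-28; row G-an2-4 ∕ (CONV-C), TRANSFER-III, the (III′) S-slot (b), born-V contact letters `hCv ∕ hPcV`
of road-P2 M.104 — TABLE HALF at an1's (0.4)-SYMMETRISED border table `symVhSAt ρ` and (0.4) packed first-order kernel `linSym04At ρ L` (the OWNER's memo `HCV-DESIGN-g55.md` §1∕§2):
a mkroot-style token re-run of the (E) file named below with `vhSAt ρ ↦ symVhSAt ρ`, `linSymAt ↦ linSym04At`, `linKerAt ∕ linCountAt ∕ linAvgAt ↦ symLinKerAt ∕ symLinCountAt ∕ symLinAvgAt`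
(an1's `SymAveragingHessianCounts`, d1's `SymmetrisedAxialPotential`), the `q¹`-pairing normalisation `(L^{d+1})⁻¹ ↦ ((d+1)!·L^{d+1})⁻¹` (leaf-02 g55 `SymLinKernelExpansion.tsum_sum_symLinKerAt_mul`)
and the count constant `L^{d+1}·ℓ ↦ (d+1)!·(L^{d+1}·ℓ)` (an1's `abs_symLinCountAt_le`, leaf-01 g90's `SymContactFaceJumpCommutator.sum_abs_symLinCountAt_le`) carried VERBATIM through every
statement; every TABLE-FREE lemma of the (E) files is consumed BY NAME (not copied), and leaf-01 g90's `SymContactFaceJump ∕ SymContactFaceJumpCommutator` supply the shared sym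
count ∕ commutator letters.  [folklore] bookkeeping; 0 `def`, 0 cited fact, 0 `def … : Prop`, 0 sorry; NO estimate of Bałaban's beyond an1's DEFINED kernels.
HONEST FRAMING (cell contract, verbatim): «discharging `BetaPertH` makes Bałaban's UV stability UNCONDITIONAL — a real constructive-QFT result; it is NOT the continuum limit
and NOT the Clay problem.»  HONEST DEPENDENCY (verbatim): «continuum YM on T⁴ ⇐ BetaPertH ∧ nine spine estimates (0/9 proved); BetaPertH ⇐ (D1) ∧ (D4) ∧ CAP+tail; G-an2-4
gates asym, D1 and NE2/3/4.»  Discharges NO letter of M.104 ∕ of the OWNER's END `CombChargeRowsOfBornContactLetters` (hCv ∕ hPcV stay HYPOTHESES); NEVER «G-an2-4 closed» as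
(CONV-C); NOT D1, NOT BetaPertH, NOT continuum, NOT Clay.  2026-08-28; no existing file touched.

## What (same statements as the (E) file under the substitutions above; `Sym…` namespace)
`sum_abs_symLinCountAt_le_cnt`, `abs_sum_tsum_tip_le`, `abs_sum_tsum_root_le`, `abs_sum_tsum_tip_dz_le`, `abs_contact_border_fm_le`.
-/

noncomputable section

open Summit.QuantumFields.BalabanUV.Beta.GAN24.ContactBorderEntryBound (tsum_sum_mul_ite_off_eq)

open Finset
open scoped BigOperators
open Literature.MathematicalPhysics.QuantumFieldTheory
open Literature.MathematicalPhysics.QuantumFieldTheory.LatticeForm (quo)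
open Literature.MathematicalPhysics.QuantumFieldTheory.Balaban1983to89
open Literature.MathematicalPhysics.QuantumFieldTheory.Balaban1983to89.Beta
open Literature.Probability.LatticeModels (Torus.proj)
open B4ContourShift (supNorm supNorm_nonneg)
open B12Sec2to5 (l1 l1_nonneg)
open ExpKernelCalculus (MKer Zl Zl_nonneg)
open AffineAveraging (Form0 Form1 Site box toSite unitVec dz)
open AveragingContours (blk off)

open AveragingHessianKernels (ell eq_smul_blk_of_off_eq_zero)

open AxialProjector (blk_zsmul)
open RootedKernelReflection (off_zsmul)
open ResolventComposition (tsum_sublattice₀)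
open OneStepResolventKernel (Fib proj_zsmul)
open Summit.QuantumFields.BalabanUV.Beta.LinearGaugeVH (nearBox mem_nearBox)
open Summit.QuantumFields.BalabanUV.Beta.GAN24.SrecLinearPartEq (reslot)
open Summit.QuantumFields.BalabanUV.Beta.GAN24.Push3 (push₃)
open Summit.QuantumFields.BalabanUV.Beta.GAN24.Push3LegTelescope (abs_le_of_env' summable_of_env')
open Summit.QuantumFields.BalabanUV.Beta.GAN24.ContactLambdaEntryBound (mul_sum_ite)
open Summit.QuantumFields.BalabanUV.Beta.GAN24.SymContactLambdaEntryBound (sum_abs_symLinCountAt_le_cnt)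
open Summit.QuantumFields.BalabanUV.Beta.GAN24.SymContactFaceJumpCommutator (sum_abs_symLinCountAt_le)
open Summit.QuantumFields.BalabanUV.Beta.GAN24.Push3BorderGaugeSlotCells (card_nearBox)
open Summit.QuantumFields.BalabanUV.Beta.GAN24.SymContactFaceJumpBorder (tipCommutator_eq_sum)
open Summit.QuantumFields.BalabanUV.Beta.GAN24.ContactLambdaCellBound (abs_sum_tsum_mul_le_of_env3)
open Summit.QuantumFields.BalabanUV.Beta.GAN24.ContactGaugeStaircaseLocal (env_label_le corner_le_of_mem_nearBox corner_le_of_mem_nearBox_add corner_le_root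
  corner_le_root_add abs_finest_le_env abs_dz_finest_le_env sum_abs_jump_le_env)
open Summit.QuantumFields.BalabanUV.Beta.GAN24.SymContactBorderCellLetters (abs_tipCommutator_le_of_staircase_of_env abs_rootCommutator_le_of_staircase_of_env
  abs_tipCommutator_dz_le_of_staircase_of_env)
open Summit.QuantumFields.BalabanUV.Beta.GAN24.SymContactBorderCommutator (contact_border_fm_eq_factorised)

open Summit.QuantumFields.BalabanUV.Beta.SymmetrisedAxialPotential (symLinAvgAt)

open Summit.QuantumFields.BalabanUV.Beta.SymAveragingHessianCounts (symVhSAt symVhSAt_symm locStencil_symVhSAt symLinCountAt symLinKerAt abs_symLinCountAt_le abs_symLinKerAt_le symLinCountAt_eq_zero symLinKerAt_eq_zero)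

namespace Summit.QuantumFields.BalabanUV.Beta.GAN24.SymContactBorderEntryBound

variable {d : ℕ} {Lc : ℕ} {rr : Fin (d + 1) → ℕ}


/-! ## §1 The three V cell sums -/

section Tip

variable {n : ℕ} {κ αg KB Tb : ℝ} {Gs : ℕ → Site (d + 1) → ℝ} {ψ : Site (d + 1) → ℝ} {R : Form1 (d + 1) ℝ}
  {b : Fin (d + 1) → Site (d + 1) → ℝ} {xg xl u' : Site (d + 1)}

/-- NOT IN PRINT; OUR BOOKKEEPING ([folklore]; every input a letter).  **THE TIP CELL** (undressed leg): brackets under the tent letter at blocking `Lc^n` and label `u′`, a gauge staircase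
`ψ = Σ_{s<n+1} G s ∘ blk (Lc^s)` with localised geometric pieces (source label `x_g`), a leg under a block envelope (label `x_l`):
`|Σ_μ Σ'_y b μ y·(symLinAvgAt ρ (ψ⁺•R) Lc μ y − ψ(Lc·y+ρ+Lc·e_μ)·symLinAvgAt ρ R Lc μ y)| ≤ (d+1)·T_b·(E₀²·K_B·Cnt)·(2α_g + 2·α_g·Lc·n)·((Lc^n)^{d+1}·Zl)·e^{−(κ∕12)(‖x_g − u′‖∞ + ‖x_l − u′‖∞)}`
and every `y`-family is summable (finest tip weight: TWO sites, `2α_g`). -/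
theorem abs_sum_tsum_tip_le (hLc : 1 ≤ Lc) (hrr : rr ∈ box (d + 1) Lc) (hκ : 0 < κ) (hαg : 0 ≤ αg) (hKB : 0 ≤ KB) (hTb : 0 ≤ Tb)
    (hψ : ∀ u, ψ u = ∑ s ∈ Finset.range (n + 1), Gs s (blk (Lc ^ s) u))
    (hG : ∀ s, s ≤ n → ∀ u, |Gs s (blk (Lc ^ s) u)| ≤ αg * (Lc : ℝ) ^ s * Real.exp (-(κ * supNorm (quo (Lc ^ (n + 1)) u - xg))))
    (hR : ∀ a x, |R a x| ≤ KB * Real.exp (-(κ * supNorm (quo (Lc ^ (n + 1)) x - xl))))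
    (hb : ∀ μ y, |b μ y| ≤ Tb * Real.exp (-(κ * supNorm (quo (Lc ^ n) y - u')))) :
    (∀ μ, Summable fun y : Site (d + 1) => b μ y *
        (symLinAvgAt (toSite rr) (fun a x => ψ (x + unitVec a) * R a x) Lc μ y
          - ψ ((Lc : ℤ) • y + toSite rr + (Lc : ℤ) • unitVec μ) * symLinAvgAt (toSite rr) R Lc μ y)) ∧
    |∑ μ, ∑' y : Site (d + 1), b μ y *
        (symLinAvgAt (toSite rr) (fun a x => ψ (x + unitVec a) * R a x) Lc μ y
          - ψ ((Lc : ℤ) • y + toSite rr + (Lc : ℤ) • unitVec μ) * symLinAvgAt (toSite rr) R Lc μ y)|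
      ≤ ((d : ℝ) + 1) * Tb * (Real.exp (2 * ((d : ℝ) + 1) * κ) ^ 2 * KB *
            (((2 * Lc : ℕ) : ℝ) ^ (d + 1) * (((d + 1 : ℕ) : ℝ) * ((((d + 1).factorial : ℕ) : ℝ) * ((Lc : ℝ) ^ (d + 1) * (ell (d + 1) Lc : ℝ))))))
          * (2 * αg + 2 * αg * Lc * n) * ((((Lc ^ n : ℕ) : ℝ)) ^ (d + 1) * Zl (d + 1) (κ / (4 * ((d : ℝ) + 1)))) *
          Real.exp (-(κ / 12) * (supNorm (xg - u') + supNorm (xl - u'))) := by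
  set E₀ : ℝ := Real.exp (2 * ((d : ℝ) + 1) * κ) with hE₀
  set Cnt : ℝ := ((2 * Lc : ℕ) : ℝ) ^ (d + 1) * (((d + 1 : ℕ) : ℝ) * ((((d + 1).factorial : ℕ) : ℝ) * ((Lc : ℝ) ^ (d + 1) * (ell (d + 1) Lc : ℝ)))) with hCnt
  have hE₀0 : 0 ≤ E₀ := (Real.exp_pos _).le
  have hLn : 1 ≤ Lc ^ n := Nat.one_le_pow _ _ hLc
  have hc : ∀ μ y, |symLinAvgAt (toSite rr) (fun a x => ψ (x + unitVec a) * R a x) Lc μ y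
        - ψ ((Lc : ℤ) • y + toSite rr + (Lc : ℤ) • unitVec μ) * symLinAvgAt (toSite rr) R Lc μ y|
      ≤ (2 * αg + ∑ s ∈ Finset.range n, (if (Lc : ℤ) ^ s ∣ y μ + 1 then 2 * ((fun m => αg * (Lc : ℝ) ^ m) (s + 1)) else 0)) *
        ((E₀ ^ 2 * KB * Cnt) * Real.exp (-(κ * supNorm (quo (Lc ^ n) y - xg))) * Real.exp (-(κ * supNorm (quo (Lc ^ n) y - xl)))) := by
    intro μ y
    have hW : ∀ a, ∀ x ∈ nearBox Lc y, |Gs 0 (x + unitVec a) - Gs 0 ((Lc : ℤ) • y + toSite rr + (Lc : ℤ) • unitVec μ)|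
        ≤ 2 * αg * (E₀ * Real.exp (-(κ * supNorm (quo (Lc ^ n) y - xg)))) := by
      intro a x hx
      have h1 := abs_finest_le_env hLc hκ.le hαg hG (corner_le_of_mem_nearBox_add hLc hx a)
      have h2 := abs_finest_le_env hLc hκ.le hαg hG (corner_le_root_add hrr y μ)
      calc |Gs 0 (x + unitVec a) - Gs 0 ((Lc : ℤ) • y + toSite rr + (Lc : ℤ) • unitVec μ)|
          ≤ |Gs 0 (x + unitVec a)| + |Gs 0 ((Lc : ℤ) • y + toSite rr + (Lc : ℤ) • unitVec μ)| := abs_sub _ _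
        _ ≤ _ := by linarith
    have hJ := sum_abs_jump_le_env hLc hκ.le hαg hG μ y
    have hB : ∀ a, ∀ x ∈ nearBox Lc y, |R a x| ≤ KB * (E₀ * Real.exp (-(κ * supNorm (quo (Lc ^ n) y - xl)))) := fun a x hx =>
      (hR a x).trans (mul_le_mul_of_nonneg_left (env_label_le hLc hκ.le n xl (corner_le_of_mem_nearBox hx)) hKB)
    have h := abs_tipCommutator_le_of_staircase_of_env hLc hrr Gs n hψ R μ y (W₀ := 2 * αg)
      (F := ∑ s ∈ Finset.range n, (if (Lc : ℤ) ^ s ∣ y μ + 1 then 2 * (αg * (Lc : ℝ) ^ (s + 1)) else 0))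
      (E := E₀ * Real.exp (-(κ * supNorm (quo (Lc ^ n) y - xg)))) (M := KB * (E₀ * Real.exp (-(κ * supNorm (quo (Lc ^ n) y - xl)))))
      (by positivity) (by positivity) (by positivity) hW hJ hB (sum_abs_symLinCountAt_le_cnt hLc hrr μ y)
    refine h.trans (le_of_eq ?_)
    simp only []
    ring
  have ha : ∀ s, s < n → 0 ≤ (fun m => αg * (Lc : ℝ) ^ m) (s + 1) ∧ (fun m => αg * (Lc : ℝ) ^ m) (s + 1) ≤ αg * (Lc : ℝ) ^ (s + 1) :=
    fun s _ => ⟨by positivity, le_rfl⟩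
  exact abs_sum_tsum_mul_le_of_env3 (d := d) (Lc := Lc) (M := Lc ^ n) (n := n) hLc hLn (fun s hs => pow_dvd_pow Lc hs.le) hκ
    (a := fun m => αg * (Lc : ℝ) ^ m) ha (b := b)
    (c := fun μ y => symLinAvgAt (toSite rr) (fun a x => ψ (x + unitVec a) * R a x) Lc μ y
          - ψ ((Lc : ℤ) • y + toSite rr + (Lc : ℤ) • unitVec μ) * symLinAvgAt (toSite rr) R Lc μ y)
    hTb (by positivity : 0 ≤ E₀ ^ 2 * KB * Cnt) (by positivity : (0 : ℝ) ≤ 2 * αg) u' xg xl hb hc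

/-- NOT IN PRINT; OUR BOOKKEEPING ([folklore]; every input a letter).  **THE ROOT CELL** (undressed leg): same letters, the ROOT commutator
`ψ(Lc·y+ρ)·symLinAvgAt ρ R Lc μ y − symLinAvgAt ρ (ψ•R) Lc μ y`; same constant as the TIP cell. -/
theorem abs_sum_tsum_root_le (hLc : 1 ≤ Lc) (hrr : rr ∈ box (d + 1) Lc) (hκ : 0 < κ) (hαg : 0 ≤ αg) (hKB : 0 ≤ KB) (hTb : 0 ≤ Tb)
    (hψ : ∀ u, ψ u = ∑ s ∈ Finset.range (n + 1), Gs s (blk (Lc ^ s) u))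
    (hG : ∀ s, s ≤ n → ∀ u, |Gs s (blk (Lc ^ s) u)| ≤ αg * (Lc : ℝ) ^ s * Real.exp (-(κ * supNorm (quo (Lc ^ (n + 1)) u - xg))))
    (hR : ∀ a x, |R a x| ≤ KB * Real.exp (-(κ * supNorm (quo (Lc ^ (n + 1)) x - xl))))
    (hb : ∀ μ y, |b μ y| ≤ Tb * Real.exp (-(κ * supNorm (quo (Lc ^ n) y - u')))) :
    (∀ μ, Summable fun y : Site (d + 1) => b μ y *
        (ψ ((Lc : ℤ) • y + toSite rr) * symLinAvgAt (toSite rr) R Lc μ y - symLinAvgAt (toSite rr) (fun a x => ψ x * R a x) Lc μ y)) ∧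
    |∑ μ, ∑' y : Site (d + 1), b μ y *
        (ψ ((Lc : ℤ) • y + toSite rr) * symLinAvgAt (toSite rr) R Lc μ y - symLinAvgAt (toSite rr) (fun a x => ψ x * R a x) Lc μ y)|
      ≤ ((d : ℝ) + 1) * Tb * (Real.exp (2 * ((d : ℝ) + 1) * κ) ^ 2 * KB *
            (((2 * Lc : ℕ) : ℝ) ^ (d + 1) * (((d + 1 : ℕ) : ℝ) * ((((d + 1).factorial : ℕ) : ℝ) * ((Lc : ℝ) ^ (d + 1) * (ell (d + 1) Lc : ℝ))))))
          * (2 * αg + 2 * αg * Lc * n) * ((((Lc ^ n : ℕ) : ℝ)) ^ (d + 1) * Zl (d + 1) (κ / (4 * ((d : ℝ) + 1)))) *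
          Real.exp (-(κ / 12) * (supNorm (xg - u') + supNorm (xl - u'))) := by
  set E₀ : ℝ := Real.exp (2 * ((d : ℝ) + 1) * κ) with hE₀
  set Cnt : ℝ := ((2 * Lc : ℕ) : ℝ) ^ (d + 1) * (((d + 1 : ℕ) : ℝ) * ((((d + 1).factorial : ℕ) : ℝ) * ((Lc : ℝ) ^ (d + 1) * (ell (d + 1) Lc : ℝ)))) with hCnt
  have hE₀0 : 0 ≤ E₀ := (Real.exp_pos _).le
  have hLn : 1 ≤ Lc ^ n := Nat.one_le_pow _ _ hLc
  have hc : ∀ μ y, |ψ ((Lc : ℤ) • y + toSite rr) * symLinAvgAt (toSite rr) R Lc μ y - symLinAvgAt (toSite rr) (fun a x => ψ x * R a x) Lc μ y|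
      ≤ (2 * αg + ∑ s ∈ Finset.range n, (if (Lc : ℤ) ^ s ∣ y μ + 1 then 2 * ((fun m => αg * (Lc : ℝ) ^ m) (s + 1)) else 0)) *
        ((E₀ ^ 2 * KB * Cnt) * Real.exp (-(κ * supNorm (quo (Lc ^ n) y - xg))) * Real.exp (-(κ * supNorm (quo (Lc ^ n) y - xl)))) := by
    intro μ y
    have hW : ∀ x ∈ nearBox Lc y, |Gs 0 ((Lc : ℤ) • y + toSite rr) - Gs 0 x| ≤ 2 * αg * (E₀ * Real.exp (-(κ * supNorm (quo (Lc ^ n) y - xg)))) := by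
      intro x hx
      have h1 := abs_finest_le_env hLc hκ.le hαg hG (corner_le_root hrr y)
      have h2 := abs_finest_le_env hLc hκ.le hαg hG (corner_le_of_mem_nearBox hx)
      calc |Gs 0 ((Lc : ℤ) • y + toSite rr) - Gs 0 x| ≤ |Gs 0 ((Lc : ℤ) • y + toSite rr)| + |Gs 0 x| := abs_sub _ _
        _ ≤ _ := by linarith
    have hJ := sum_abs_jump_le_env hLc hκ.le hαg hG μ y
    have hB : ∀ a, ∀ x ∈ nearBox Lc y, |R a x| ≤ KB * (E₀ * Real.exp (-(κ * supNorm (quo (Lc ^ n) y - xl)))) := fun a x hx =>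
      (hR a x).trans (mul_le_mul_of_nonneg_left (env_label_le hLc hκ.le n xl (corner_le_of_mem_nearBox hx)) hKB)
    have h := abs_rootCommutator_le_of_staircase_of_env hLc hrr Gs n hψ R μ y (W₀ := 2 * αg)
      (F := ∑ s ∈ Finset.range n, (if (Lc : ℤ) ^ s ∣ y μ + 1 then 2 * (αg * (Lc : ℝ) ^ (s + 1)) else 0))
      (E := E₀ * Real.exp (-(κ * supNorm (quo (Lc ^ n) y - xg)))) (M := KB * (E₀ * Real.exp (-(κ * supNorm (quo (Lc ^ n) y - xl)))))
      (by positivity) (by positivity) (by positivity) hW hJ hB (sum_abs_symLinCountAt_le_cnt hLc hrr μ y)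
    refine h.trans (le_of_eq ?_)
    simp only []
    ring
  have ha : ∀ s, s < n → 0 ≤ (fun m => αg * (Lc : ℝ) ^ m) (s + 1) ∧ (fun m => αg * (Lc : ℝ) ^ m) (s + 1) ≤ αg * (Lc : ℝ) ^ (s + 1) :=
    fun s _ => ⟨by positivity, le_rfl⟩
  exact abs_sum_tsum_mul_le_of_env3 (d := d) (Lc := Lc) (M := Lc ^ n) (n := n) hLc hLn (fun s hs => pow_dvd_pow Lc hs.le) hκ
    (a := fun m => αg * (Lc : ℝ) ^ m) ha (b := b)
    (c := fun μ y => ψ ((Lc : ℤ) • y + toSite rr) * symLinAvgAt (toSite rr) R Lc μ y - symLinAvgAt (toSite rr) (fun a x => ψ x * R a x) Lc μ y)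
    hTb (by positivity : 0 ≤ E₀ ^ 2 * KB * Cnt) (by positivity : (0 : ℝ) ≤ 2 * αg) u' xg xl hb hc

end Tip

section TipDz

variable {n : ℕ} {κ αg Tb : ℝ} {Ga Gb : ℕ → Site (d + 1) → ℝ} {ψa ψb : Site (d + 1) → ℝ}
  {b : Fin (d + 1) → Site (d + 1) → ℝ} {xg xl u' : Site (d + 1)}

/-- NOT IN PRINT; OUR BOOKKEEPING ([folklore]; every input a letter).  **THE TIP × GRADIENT CELL**: two gauge staircases with localised geometric pieces of the same letter `α_g`
(sources `x_g`, `x_l`), brackets under the tent letter: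
`|Σ_μ Σ'_y b μ y·[tip commutator of ψ_a](dz ψ_b)(μ,y)| ≤ (d+1)·T_b·(E₀²·Cnt)·(4α_g² + 2·(4α_g²)·Lc·n)·((Lc^n)^{d+1}·Zl)·e^{−(κ∕12)(‖x_g − u′‖∞ + ‖x_l − u′‖∞)}` and every `y`-family is summable. -/
theorem abs_sum_tsum_tip_dz_le (hLc : 1 ≤ Lc) (hrr : rr ∈ box (d + 1) Lc) (hκ : 0 < κ) (hαg : 0 ≤ αg) (hTb : 0 ≤ Tb)
    (hψa : ∀ u, ψa u = ∑ s ∈ Finset.range (n + 1), Ga s (blk (Lc ^ s) u))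
    (hψb : ∀ u, ψb u = ∑ s ∈ Finset.range (n + 1), Gb s (blk (Lc ^ s) u))
    (hGa : ∀ s, s ≤ n → ∀ u, |Ga s (blk (Lc ^ s) u)| ≤ αg * (Lc : ℝ) ^ s * Real.exp (-(κ * supNorm (quo (Lc ^ (n + 1)) u - xg))))
    (hGb : ∀ s, s ≤ n → ∀ u, |Gb s (blk (Lc ^ s) u)| ≤ αg * (Lc : ℝ) ^ s * Real.exp (-(κ * supNorm (quo (Lc ^ (n + 1)) u - xl))))
    (hb : ∀ μ y, |b μ y| ≤ Tb * Real.exp (-(κ * supNorm (quo (Lc ^ n) y - u')))) :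
    (∀ μ, Summable fun y : Site (d + 1) => b μ y *
        (symLinAvgAt (toSite rr) (fun a x => ψa (x + unitVec a) * dz ψb a x) Lc μ y
          - ψa ((Lc : ℤ) • y + toSite rr + (Lc : ℤ) • unitVec μ) * symLinAvgAt (toSite rr) (dz ψb) Lc μ y)) ∧
    |∑ μ, ∑' y : Site (d + 1), b μ y *
        (symLinAvgAt (toSite rr) (fun a x => ψa (x + unitVec a) * dz ψb a x) Lc μ y
          - ψa ((Lc : ℤ) • y + toSite rr + (Lc : ℤ) • unitVec μ) * symLinAvgAt (toSite rr) (dz ψb) Lc μ y)|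
      ≤ ((d : ℝ) + 1) * Tb * (Real.exp (2 * ((d : ℝ) + 1) * κ) ^ 2 *
            (((2 * Lc : ℕ) : ℝ) ^ (d + 1) * (((d + 1 : ℕ) : ℝ) * ((((d + 1).factorial : ℕ) : ℝ) * ((Lc : ℝ) ^ (d + 1) * (ell (d + 1) Lc : ℝ))))))
          * (4 * αg ^ 2 + 2 * (4 * αg ^ 2) * Lc * n) * ((((Lc ^ n : ℕ) : ℝ)) ^ (d + 1) * Zl (d + 1) (κ / (4 * ((d : ℝ) + 1)))) *
          Real.exp (-(κ / 12) * (supNorm (xg - u') + supNorm (xl - u'))) := by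
  set E₀ : ℝ := Real.exp (2 * ((d : ℝ) + 1) * κ) with hE₀
  set Cnt : ℝ := ((2 * Lc : ℕ) : ℝ) ^ (d + 1) * (((d + 1 : ℕ) : ℝ) * ((((d + 1).factorial : ℕ) : ℝ) * ((Lc : ℝ) ^ (d + 1) * (ell (d + 1) Lc : ℝ)))) with hCnt
  have hE₀0 : 0 ≤ E₀ := (Real.exp_pos _).le
  have hLn : 1 ≤ Lc ^ n := Nat.one_le_pow _ _ hLc
  have hc : ∀ μ y, |symLinAvgAt (toSite rr) (fun a x => ψa (x + unitVec a) * dz ψb a x) Lc μ y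
        - ψa ((Lc : ℤ) • y + toSite rr + (Lc : ℤ) • unitVec μ) * symLinAvgAt (toSite rr) (dz ψb) Lc μ y|
      ≤ (4 * αg ^ 2 + ∑ s ∈ Finset.range n, (if (Lc : ℤ) ^ s ∣ y μ + 1 then 2 * ((fun m => 4 * αg * (αg * (Lc : ℝ) ^ m)) (s + 1)) else 0)) *
        ((E₀ ^ 2 * Cnt) * Real.exp (-(κ * supNorm (quo (Lc ^ n) y - xg))) * Real.exp (-(κ * supNorm (quo (Lc ^ n) y - xl)))) := by
    intro μ y
    classical
    have hWa : ∀ a, ∀ x ∈ nearBox Lc y, |Ga 0 (x + unitVec a) - Ga 0 ((Lc : ℤ) • y + toSite rr + (Lc : ℤ) • unitVec μ)|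
        ≤ 2 * αg * (E₀ * Real.exp (-(κ * supNorm (quo (Lc ^ n) y - xg)))) := by
      intro a x hx
      have h1 := abs_finest_le_env hLc hκ.le hαg hGa (corner_le_of_mem_nearBox_add hLc hx a)
      have h2 := abs_finest_le_env hLc hκ.le hαg hGa (corner_le_root_add hrr y μ)
      calc |Ga 0 (x + unitVec a) - Ga 0 ((Lc : ℤ) • y + toSite rr + (Lc : ℤ) • unitVec μ)|
          ≤ |Ga 0 (x + unitVec a)| + |Ga 0 ((Lc : ℤ) • y + toSite rr + (Lc : ℤ) • unitVec μ)| := abs_sub _ _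
        _ ≤ _ := by linarith
    have hgb := fun a x (hx : x ∈ nearBox Lc y) => abs_dz_finest_le_env hLc hκ.le hαg hGb y a hx
    have hJa := sum_abs_jump_le_env hLc hκ.le hαg hGa μ y
    have hJb := sum_abs_jump_le_env hLc hκ.le hαg hGb μ y
    have h := abs_tipCommutator_dz_le_of_staircase_of_env hLc hrr Ga Gb n hψa hψb μ y (Wa := 2 * αg) (gb := 2 * αg)
      (F := ∑ s ∈ Finset.range n, (if (Lc : ℤ) ^ s ∣ y μ + 1 then 2 * (αg * (Lc : ℝ) ^ (s + 1)) else 0))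
      (Ea := E₀ * Real.exp (-(κ * supNorm (quo (Lc ^ n) y - xg)))) (Eb := E₀ * Real.exp (-(κ * supNorm (quo (Lc ^ n) y - xl))))
      (by positivity) (by positivity) (by positivity) (by positivity) hWa hgb hJa hJb (sum_abs_symLinCountAt_le_cnt hLc hrr μ y)
    refine h.trans (le_of_eq ?_)
    rw [show (2 * αg + 2 * αg) * ∑ s ∈ Finset.range n, (if (Lc : ℤ) ^ s ∣ y μ + 1 then 2 * (αg * (Lc : ℝ) ^ (s + 1)) else 0)
      = ∑ s ∈ Finset.range n, (if (Lc : ℤ) ^ s ∣ y μ + 1 then 2 * ((fun m => 4 * αg * (αg * (Lc : ℝ) ^ m)) (s + 1)) else 0) by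
        rw [show (2 * αg + 2 * αg) = 4 * αg by ring, mul_sum_ite]]
    ring
  have ha : ∀ s, s < n → 0 ≤ (fun m => 4 * αg * (αg * (Lc : ℝ) ^ m)) (s + 1) ∧
      (fun m => 4 * αg * (αg * (Lc : ℝ) ^ m)) (s + 1) ≤ (4 * αg ^ 2) * (Lc : ℝ) ^ (s + 1) :=
    fun s _ => ⟨by positivity, le_of_eq (by simp only []; ring)⟩
  exact abs_sum_tsum_mul_le_of_env3 (d := d) (Lc := Lc) (M := Lc ^ n) (n := n) hLc hLn (fun s hs => pow_dvd_pow Lc hs.le) hκ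
    (a := fun m => 4 * αg * (αg * (Lc : ℝ) ^ m)) ha (b := b)
    (c := fun μ y => symLinAvgAt (toSite rr) (fun a x => ψa (x + unitVec a) * dz ψb a x) Lc μ y
          - ψa ((Lc : ℤ) • y + toSite rr + (Lc : ℤ) • unitVec μ) * symLinAvgAt (toSite rr) (dz ψb) Lc μ y)
    hTb (by positivity : 0 ≤ E₀ ^ 2 * Cnt) (by positivity : (0 : ℝ) ≤ 4 * αg ^ 2) u' xg xl hb hc

end TipDz

/-! ## §2 The entry bound of the fm-channel V contact difference -/

section Entry

variable [NeZero Lc] {n : ℕ} {κ αg KB CT Tb : ℝ}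
  {T B M : Fin (d + 1) → (Fin (d + 1) → ℤ) → Fin (d + 1) → (Fin (d + 1) → ℤ) → ℝ}
  {lam : Fin (d + 1) → (Fin (d + 1) → ℤ) → (Fin (d + 1) → ℤ) → ℝ}
  {G : Fin (d + 1) → (Fin (d + 1) → ℤ) → ℕ → Site (d + 1) → ℝ}


/-- NOT IN PRINT; OUR BOOKKEEPING ([folklore]; BORNV-PLAN-v0 §4 ∕ BORNSEC-PLAN v1.1 §0 (c) + §0′ per lineage, every analytic input a LETTER).  **THE ENTRY BOUND OF THE fm-CHANNEL V CONTACT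
DIFFERENCE.**  Legs `T` (dressed: bounded with summable fine slices) and `B` (undressed: block envelope `K_B·e^{−κ‖quo (Lc^{n+1}) u − z‖∞}`) with `T − B = dz λ`, the bond gauge
functions `λ_{μ₀z₀}` staircases of depth `n+1` with localised geometric pieces (`α_g·Lc^s`, source label `z₀`), a COMMON multiplier leg `M` with summable fine slices under the TENT letter
`|M β z′ μ (Lc•y)| ≤ T_b·e^{−κ‖quo (Lc^n) y − z′‖∞}`.  THEN for all `κ′ u′ x′ z′ α β`, with `V_ρ = symVhSAt ρ d Lc` the bare rooted border table,
`|push₃ T M T (reslot inl inr V_ρ) κ′u′ x′z′ (inl α)(inl β) − push₃ B M B (reslot inl inr V_ρ) κ′u′ x′z′ (inl α)(inl β)|`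
`≤ (Lc^{d+1})⁻¹·((d+1)·T_b·(E₀²·Cnt))·(2·K_B·(2α_g + 2α_g·Lc·n) + (4α_g² + 8α_g²·Lc·n))·((Lc^n)^{d+1}·Zl(κ∕(4(d+1))))·e^{−(κ∕12)(‖x′−z′‖∞ + ‖u′−z′‖∞)}`
— leaf-02 g48's socket `contact_border_fm_eq_factorised` (lᴱ = wᴱ = T, lᴮ = wᴮ = B, common `M`), the sublattice re-indexing, the split `T = B + dz λ` of the TIP cell's dressed leg
(`tipCommutator_eq_sum` is linear in the leg), then §1's TIP, TIP × GRADIENT and ROOT cells. -/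
theorem abs_contact_border_fm_le (hLc : 1 ≤ Lc) (hrr : rr ∈ box (d + 1) Lc) (hκ : 0 < κ) (hαg : 0 ≤ αg) (hKB : 0 ≤ KB) (hTb : 0 ≤ Tb)
    (hT : ∀ μ z κ u, |T μ z κ u| ≤ CT) (hTs : ∀ μ z κ, Summable fun u => T μ z κ u)
    (hB : ∀ μ z l u, |B μ z l u| ≤ KB * Real.exp (-(κ * supNorm (quo (Lc ^ (n + 1)) u - z))))
    (hTB : T - B = fun μ z κ u => dz (lam μ z) κ u)
    (hψ : ∀ μ₀ z₀ u, lam μ₀ z₀ u = ∑ s ∈ Finset.range (n + 1), G μ₀ z₀ s (blk (Lc ^ s) u))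
    (hG : ∀ μ₀ z₀ s, s ≤ n → ∀ u, |G μ₀ z₀ s (blk (Lc ^ s) u)| ≤ αg * (Lc : ℝ) ^ s * Real.exp (-(κ * supNorm (quo (Lc ^ (n + 1)) u - z₀))))
    (hMs : ∀ β z' μ, Summable fun z => M β z' μ z)
    (hMt : ∀ (β : Fin (d + 1)) (z' : Site (d + 1)) (μ : Fin (d + 1)) (y : Site (d + 1)),
      |M β z' μ ((Lc : ℤ) • y)| ≤ Tb * Real.exp (-(κ * supNorm (quo (Lc ^ n) y - z'))))
    (κ' : Fin (d + 1)) (u' x' z' : Site (d + 1)) (α β : Fin (d + 1)) :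
    |push₃ T M T (reslot Sum.inl Sum.inr (symVhSAt (toSite rr) d Lc rfl)) κ' u' x' z' (Sum.inl α) (Sum.inl β)
        - push₃ B M B (reslot Sum.inl Sum.inr (symVhSAt (toSite rr) d Lc rfl)) κ' u' x' z' (Sum.inl α) (Sum.inl β)|
      ≤ ((((d + 1).factorial : ℕ) : ℝ) * (Lc : ℝ) ^ (d + 1))⁻¹ *
          ((((d : ℝ) + 1) * Tb * (Real.exp (2 * ((d : ℝ) + 1) * κ) ^ 2 *
              (((2 * Lc : ℕ) : ℝ) ^ (d + 1) * (((d + 1 : ℕ) : ℝ) * ((((d + 1).factorial : ℕ) : ℝ) * ((Lc : ℝ) ^ (d + 1) * (ell (d + 1) Lc : ℝ)))))))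
            * (2 * KB * (2 * αg + 2 * αg * Lc * n) + (4 * αg ^ 2 + 2 * (4 * αg ^ 2) * Lc * n))
            * ((((Lc ^ n : ℕ) : ℝ)) ^ (d + 1) * Zl (d + 1) (κ / (4 * ((d : ℝ) + 1))))
            * Real.exp (-(κ / 12) * (supNorm (x' - z') + supNorm (u' - z')))) := by
  -- the leg class of `B` and the socket
  have hLn1 : 1 ≤ Lc ^ (n + 1) := Nat.one_le_pow _ _ hLc
  have hBb : ∀ μ z l u, |B μ z l u| ≤ KB := abs_le_of_env' hκ.le hB
  have hBs : ∀ μ z l, Summable fun u => B μ z l u := summable_of_env' hLn1 hκ hB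
  rw [contact_border_fm_eq_factorised hLc hrr hT hTs hBb hBs hMs hT hBb hTB hTB κ' u' x' z' α β]
  -- sublattice re-indexing of the two cells
  rw [tsum_sum_mul_ite_off_eq hLc (fun μ z => M β z' μ z) (fun μ y z => ((((d + 1).factorial : ℕ) : ℝ) * (Lc : ℝ) ^ (d + 1))⁻¹ *
      (symLinAvgAt (toSite rr) (fun κ u => lam α x' (u + unitVec κ) * T κ' u' κ u) Lc μ y
        - lam α x' (z + toSite rr + (Lc : ℤ) • unitVec μ) * symLinAvgAt (toSite rr) (T κ' u') Lc μ y)),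
    tsum_sum_mul_ite_off_eq hLc (fun μ z => M β z' μ z) (fun μ y z => ((((d + 1).factorial : ℕ) : ℝ) * (Lc : ℝ) ^ (d + 1))⁻¹ *
      (lam κ' u' (z + toSite rr) * symLinAvgAt (toSite rr) (B α x') Lc μ y
        - symLinAvgAt (toSite rr) (fun a x => lam κ' u' x * B α x' a x) Lc μ y))]
  -- the split of the TIP cell's dressed leg `T κ′ u′ = B κ′ u′ + dz (λ κ′ u′)`
  have eT : ∀ b z, T κ' u' b z = B κ' u' b z + dz (lam κ' u') b z := fun b z => by
    have h := congrFun (congrFun (congrFun (congrFun hTB κ') u') b) z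
    simp only [Pi.sub_apply] at h
    linarith
  have hsplit : ∀ μ y,
      symLinAvgAt (toSite rr) (fun b z => lam α x' (z + unitVec b) * T κ' u' b z) Lc μ y
          - lam α x' ((Lc : ℤ) • y + toSite rr + (Lc : ℤ) • unitVec μ) * symLinAvgAt (toSite rr) (T κ' u') Lc μ y
        = (symLinAvgAt (toSite rr) (fun b z => lam α x' (z + unitVec b) * B κ' u' b z) Lc μ y
            - lam α x' ((Lc : ℤ) • y + toSite rr + (Lc : ℤ) • unitVec μ) * symLinAvgAt (toSite rr) (B κ' u') Lc μ y)
          + (symLinAvgAt (toSite rr) (fun b z => lam α x' (z + unitVec b) * dz (lam κ' u') b z) Lc μ y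
            - lam α x' ((Lc : ℤ) • y + toSite rr + (Lc : ℤ) • unitVec μ) * symLinAvgAt (toSite rr) (dz (lam κ' u')) Lc μ y) := by
    intro μ y
    rw [tipCommutator_eq_sum hrr, tipCommutator_eq_sum hrr, tipCommutator_eq_sum hrr (lam α x') (dz (lam κ' u')), ← Finset.sum_add_distrib]
    refine Finset.sum_congr rfl fun x _ => ?_
    rw [← Finset.sum_add_distrib]
    refine Finset.sum_congr rfl fun a _ => ?_
    rw [eT a x]; ring
  -- the three cells (brackets `b μ y := M β z′ μ (Lc•y)`, tent label `z′`)
  obtain ⟨hs1, hb1⟩ := abs_sum_tsum_tip_le (b := fun μ y => M β z' μ ((Lc : ℤ) • y)) (xg := x') (xl := u') (u' := z')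
    hLc hrr hκ hαg hKB hTb (hψ α x') (hG α x') (fun a x => hB κ' u' a x) (hMt β z')
  obtain ⟨hs2, hb2⟩ := abs_sum_tsum_tip_dz_le (b := fun μ y => M β z' μ ((Lc : ℤ) • y)) (xg := x') (xl := u') (u' := z')
    hLc hrr hκ hαg hTb (hψ α x') (hψ κ' u') (hG α x') (hG κ' u') (hMt β z')
  obtain ⟨hs3, hb3⟩ := abs_sum_tsum_root_le (b := fun μ y => M β z' μ ((Lc : ℤ) • y)) (xg := u') (xl := x') (u' := z')
    hLc hrr hκ hαg hKB hTb (hψ κ' u') (hG κ' u') (fun a x => hB α x' a x) (hMt β z')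
  rw [add_comm (supNorm (u' - z')) (supNorm (x' - z'))] at hb3
  -- regroup the first cell: constant out, split, exchange
  set c₀ : ℝ := ((((d + 1).factorial : ℕ) : ℝ) * (Lc : ℝ) ^ (d + 1))⁻¹ with hc₀
  have e1 : (∑' y : Site (d + 1), ∑ μ, M β z' μ ((Lc : ℤ) • y) * (c₀ *
        (symLinAvgAt (toSite rr) (fun κ u => lam α x' (u + unitVec κ) * T κ' u' κ u) Lc μ y
          - lam α x' ((Lc : ℤ) • y + toSite rr + (Lc : ℤ) • unitVec μ) * symLinAvgAt (toSite rr) (T κ' u') Lc μ y)))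
      = c₀ * ((∑ μ, ∑' y : Site (d + 1), M β z' μ ((Lc : ℤ) • y) *
          (symLinAvgAt (toSite rr) (fun b z => lam α x' (z + unitVec b) * B κ' u' b z) Lc μ y
            - lam α x' ((Lc : ℤ) • y + toSite rr + (Lc : ℤ) • unitVec μ) * symLinAvgAt (toSite rr) (B κ' u') Lc μ y))
        + ∑ μ, ∑' y : Site (d + 1), M β z' μ ((Lc : ℤ) • y) *
          (symLinAvgAt (toSite rr) (fun b z => lam α x' (z + unitVec b) * dz (lam κ' u') b z) Lc μ y
            - lam α x' ((Lc : ℤ) • y + toSite rr + (Lc : ℤ) • unitVec μ) * symLinAvgAt (toSite rr) (dz (lam κ' u')) Lc μ y)) := by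
    have step1 : ∀ y : Site (d + 1), (∑ μ, M β z' μ ((Lc : ℤ) • y) * (c₀ *
        (symLinAvgAt (toSite rr) (fun κ u => lam α x' (u + unitVec κ) * T κ' u' κ u) Lc μ y
          - lam α x' ((Lc : ℤ) • y + toSite rr + (Lc : ℤ) • unitVec μ) * symLinAvgAt (toSite rr) (T κ' u') Lc μ y)))
        = c₀ * ∑ μ, (M β z' μ ((Lc : ℤ) • y) *
            (symLinAvgAt (toSite rr) (fun b z => lam α x' (z + unitVec b) * B κ' u' b z) Lc μ y
              - lam α x' ((Lc : ℤ) • y + toSite rr + (Lc : ℤ) • unitVec μ) * symLinAvgAt (toSite rr) (B κ' u') Lc μ y)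
          + M β z' μ ((Lc : ℤ) • y) *
            (symLinAvgAt (toSite rr) (fun b z => lam α x' (z + unitVec b) * dz (lam κ' u') b z) Lc μ y
              - lam α x' ((Lc : ℤ) • y + toSite rr + (Lc : ℤ) • unitVec μ) * symLinAvgAt (toSite rr) (dz (lam κ' u')) Lc μ y)) := by
      intro y
      rw [Finset.mul_sum]
      refine Finset.sum_congr rfl fun μ _ => ?_
      rw [hsplit μ y]; ring
    rw [tsum_congr step1, tsum_mul_left, Summable.tsum_finsetSum (fun μ _ => (hs1 μ).add (hs2 μ))]
    congr 1
    rw [← Finset.sum_add_distrib]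
    exact Finset.sum_congr rfl fun μ _ => (hs1 μ).tsum_add (hs2 μ)
  have e2 : (∑' y : Site (d + 1), ∑ μ, M β z' μ ((Lc : ℤ) • y) * (c₀ *
        (lam κ' u' ((Lc : ℤ) • y + toSite rr) * symLinAvgAt (toSite rr) (B α x') Lc μ y
          - symLinAvgAt (toSite rr) (fun a x => lam κ' u' x * B α x' a x) Lc μ y)))
      = c₀ * ∑ μ, ∑' y : Site (d + 1), M β z' μ ((Lc : ℤ) • y) *
          (lam κ' u' ((Lc : ℤ) • y + toSite rr) * symLinAvgAt (toSite rr) (B α x') Lc μ y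
            - symLinAvgAt (toSite rr) (fun a x => lam κ' u' x * B α x' a x) Lc μ y) := by
    rw [← Summable.tsum_finsetSum (fun μ _ => hs3 μ), ← tsum_mul_left]
    refine tsum_congr fun y => ?_
    rw [Finset.mul_sum]
    exact Finset.sum_congr rfl fun μ _ => by ring
  rw [e1, e2, ← mul_add]
  have hc0 : 0 ≤ c₀ := by positivity
  rw [abs_mul, abs_of_nonneg hc0]
  refine (mul_le_mul_of_nonneg_left ((abs_add_le _ _).trans (add_le_add ((abs_add_le _ _).trans (add_le_add hb1 hb2)) hb3)) hc0).trans
    (le_of_eq ?_)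
  ring

end Entry

end Summit.QuantumFields.BalabanUV.Beta.GAN24.SymContactBorderEntryBound

end
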